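import Literature.AnabelianGeometry.SemiGraphs.NodNonEdgeVerticialIncidence
import Literature.AnabelianGeometry.SemiGraphs.PSCThreeChainShape
import Literature.AnabelianGeometry.SemiGraphs.PSCMultiVertexCriteria
import Literature.AnabelianGeometry.SemiGraphs.ProSigmaCuspInertia
import Literature.AnabelianGeometry.SemiGraphs.CommensurableTerminalityLemmas
import HarnessLib

/-!
# [NodNon] Lemma 1.7 at the tree's genuine carriers: criteria and instances (proof-only companion)

Hoshi–Mochizuki, *On the combinatorial anabelian geometry of nodally nondegenerate outer representations*,
Hiroshima Math. J. **41** (2011), Lemma 1.7 p. 290 [cite: HoshiMochizukiNodNon2011, Lem 1.7 p.290]: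
"`ẽ ∈ ℰ(ṽ)` ⟺ `Π_ṽ ∩ Π_ẽ ≠ {1}`; in particular, if `Π_ṽ ∩ Π_ẽ ≠ {1}`, then `Π_ẽ ⊆ Π_ṽ`."  Typed over
abc-iut-L3's `PSCDatum` in coset coordinates as the predicates `PSCDatum.EdgeVerticialContainment` /
`PSCDatum.EdgeVerticialAbutment` (`NodNonEdgeVerticialIncidence.lean`, row «NODNON-LEM17@PSC» of the
abc-iut cell; statements only, never asserted).

PROOF-ONLY companion (abc-iut-w5-d174 gen 6; no definition, no new `Prop`):

* `abuts_of_inf_ne_bot`, `edgeGp_le_vertGp_of_inf_ne_bot` — the one-line consequences recorded in the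
  statement file's docstring;
* CRITERIA `edgeVerticialContainment_of_malnormal` / `edgeVerticialAbutment_of_disjoint`: if every
  representative `Π_v` is MALNORMAL, every edge group is non-trivial, an edge group has a conjugate inside
  `Π_v` when the edge abuts `v` and meets EVERY conjugate of `Π_v` trivially when it does not, then both
  predicates hold — exactly the shape of the conclusions of the free-factor packages of the tree's genuine
  multi-vertex carriers;
* one-vertex carriers: `edgeVerticialAbutment_of_forall_eq` (every edge abuts the only vertex), and
  `edgeVerticialContainment_of_vertGp_eq_top` (smooth curves: `Π_v = Π_G`);
* **INSTANCE at every genuine THREE-COMPONENT CHAIN datum** (abc-iut-f-164's `PSCThreeChainShape.lean`,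
  two nodes, three vertices, cusps on every component) whose semi-graph records the incidences:
  `edgeVerticialContainment_of_threeChain`, `edgeVerticialAbutment_of_threeChain` — from
  `threeChain_freeFactor_package` (malnormal vertex groups; node groups inside both end groups and disjoint
  from every conjugate of the third; each cusp group inside its component's group and disjoint from every
  conjugate of the others) and `infinite_cuspInertia_closure`.

The irreducible one-nodal carrier (vertex group NOT malnormal) is treated separately by the cyclic-level
engine.  A shape instance is consistency evidence for the typed predicate, not the printed lemma for all
semi-graphs of anabelioids of PSC-type (cell FOUNDATIONS rows 13–14).  Nothing here takes a side on
[IUTchIII] Cor. 3.12.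
-/

noncomputable section

namespace Literature.AnabelianGeometry.SemiGraphs

namespace PSCDatum

open scoped Pointwise
open Literature.GroupTheory.CombinatorialGroupTheory
open Literature.GroupTheory.CombinatorialGroupTheory.PuncturedSurfaceGroup (cuspInertia)
open SemiGraphOfAnabelioids (IsProSigmaCompletion infinite_cuspInertia_closure)

universe u

section General

variable {P : Type u} [Group P] [TopologicalSpace P] (G : PSCDatum P)

omit [TopologicalSpace P] in
/-- `MulAut.conj g • H` is the tree's `ConjAct.toConjAct g • H`. [folklore] -/
private theorem mulAut_conj_smul_eq (g : P) (H : Subgroup P) :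
    MulAut.conj g • H = ConjAct.toConjAct g • H := by
  ext x
  rw [Subgroup.mem_pointwise_smul_iff_inv_smul_mem, Subgroup.mem_pointwise_smul_iff_inv_smul_mem]
  simp [ConjAct.smul_def, MulAut.conj_symm_apply]

/-- The node case of `Abuts`: `v ∈ nodeEnds n`. [cite: HoshiMochizukiNodNon2011, Def 1.1 (i) p.284] -/
theorem abuts_inl_iff (n : G.graph.N) (v : G.graph.V) :
    G.graph.Abuts (Sum.inl n) v ↔ v ∈ G.graph.nodeEnds n := Iff.rfl

/-- The cusp case of `Abuts`: `cuspEnd c = v`. [cite: HoshiMochizukiNodNon2011, Def 1.1 (i) p.284] -/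
theorem abuts_inr_iff (c : G.graph.C) (v : G.graph.V) :
    G.graph.Abuts (Sum.inr c) v ↔ G.graph.cuspEnd c = v := Iff.rfl

/-- **Lemma 1.7 (ii) ⇒ (i) on the underlying semi-graph** from the two typed predicates: a verticial and an
edge-like subgroup meeting non-trivially belong to an abutting pair of `𝔾`.
[cite: HoshiMochizukiNodNon2011, Lem 1.7 p.290] -/
theorem abuts_of_inf_ne_bot (hc : G.EdgeVerticialContainment) (ha : G.EdgeVerticialAbutment)
    {v : G.graph.V} {e : G.graph.N ⊕ G.graph.C} {g h : P}
    (hne : MulAut.conj g • G.vertGp v ⊓ MulAut.conj h • G.edgeGp e ≠ ⊥) : G.graph.Abuts e v :=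
  ha v e g h (hc v e g h hne)

/-- The containment clause at the representatives: `Π_v ∩ Π_e ≠ {1} ⇒ Π_e ⊆ Π_v`.
[cite: HoshiMochizukiNodNon2011, Lem 1.7 p.290] -/
theorem edgeGp_le_vertGp_of_inf_ne_bot (hc : G.EdgeVerticialContainment) {v : G.graph.V}
    {e : G.graph.N ⊕ G.graph.C} (hne : G.vertGp v ⊓ G.edgeGp e ≠ ⊥) : G.edgeGp e ≤ G.vertGp v := by
  have h := hc v e 1 1
  rw [map_one, one_smul, one_smul] at h
  exact h hne

omit [TopologicalSpace P] in
/-- Conjugating an intersection: `gAg⁻¹ ∩ hBh⁻¹ = g (A ∩ (g⁻¹h)B(g⁻¹h)⁻¹) g⁻¹`. [folklore] -/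
private theorem conj_inf_conj_eq (g h : P) (A B : Subgroup P) :
    ConjAct.toConjAct g • A ⊓ ConjAct.toConjAct h • B =
      ConjAct.toConjAct g • (A ⊓ ConjAct.toConjAct (g⁻¹ * h) • B) := by
  rw [Subgroup.smul_inf, ← mul_smul, ← map_mul, mul_inv_cancel_left]

/-- **Criterion for the containment clause.**  If every `Π_v` is malnormal in `Π_G`, and for every edge
`e` and vertex `v` EITHER some conjugate of `Π_e` lies in `Π_v` OR `Π_v` meets every conjugate of `Π_e`
trivially, then `G.EdgeVerticialContainment` holds: a non-trivial `gΠ_vg⁻¹ ∩ hΠ_eh⁻¹` rules out the second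
alternative, and in the first (`xΠ_ex⁻¹ ≤ Π_v`) it makes `Π_v ∩ yΠ_vy⁻¹ ≠ 1` for `y = g⁻¹hx⁻¹`, so
`y ∈ Π_v` by malnormality and `hΠ_eh⁻¹ = g·y·(xΠ_ex⁻¹)·y⁻¹·g⁻¹ ≤ gΠ_vg⁻¹`.
[cite: HoshiMochizukiNodNon2011, Lem 1.7 p.290] -/
theorem edgeVerticialContainment_of_malnormal
    (hmal : ∀ (v : G.graph.V) (x : P), G.vertGp v ⊓ ConjAct.toConjAct x • G.vertGp v ≠ ⊥ →
      x ∈ G.vertGp v)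
    (hedge : ∀ (e : G.graph.N ⊕ G.graph.C) (v : G.graph.V),
      (∃ x : P, ConjAct.toConjAct x • G.edgeGp e ≤ G.vertGp v) ∨
        ∀ x : P, G.vertGp v ⊓ ConjAct.toConjAct x • G.edgeGp e = ⊥) :
    G.EdgeVerticialContainment := by
  intro v e g h hne
  rw [mulAut_conj_smul_eq, mulAut_conj_smul_eq] at hne ⊢
  rw [conj_inf_conj_eq] at hne
  have hne' : G.vertGp v ⊓ ConjAct.toConjAct (g⁻¹ * h) • G.edgeGp e ≠ ⊥ := by
    intro hb
    apply hne
    rw [hb, Subgroup.smul_bot]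
  rcases hedge e v with ⟨x, hx⟩ | hdis
  · -- `(g⁻¹h) Π_e (g⁻¹h)⁻¹ = y (x Π_e x⁻¹) y⁻¹ ≤ y Π_v y⁻¹`, `y = g⁻¹ h x⁻¹`
    set y : P := g⁻¹ * h * x⁻¹ with hy
    have hconj : ConjAct.toConjAct (g⁻¹ * h) • G.edgeGp e ≤ ConjAct.toConjAct y • G.vertGp v := by
      have : ConjAct.toConjAct (g⁻¹ * h) • G.edgeGp e =
          ConjAct.toConjAct y • (ConjAct.toConjAct x • G.edgeGp e) := by
        rw [← mul_smul, ← map_mul, hy, inv_mul_cancel_right]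
      rw [this]
      exact Subgroup.pointwise_smul_le_pointwise_smul_iff.mpr hx
    have hyv : y ∈ G.vertGp v := by
      refine hmal v y fun hb => hne' ?_
      rw [eq_bot_iff] at hb ⊢
      exact fun z hz => hb ⟨hz.1, hconj hz.2⟩
    have hyfix : ConjAct.toConjAct y • G.vertGp v = G.vertGp v := conjAct_smul_eq_self_of_mem hyv
    rw [hyfix] at hconj
    have := Subgroup.pointwise_smul_le_pointwise_smul_iff (a := ConjAct.toConjAct g) |>.mpr hconj
    rwa [← mul_smul, ← map_mul, mul_inv_cancel_left] at this
  · exact absurd (hdis (g⁻¹ * h)) hne'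

/-- **Criterion for the abutment clause.**  If every edge group is non-trivial and `Π_v` meets every
conjugate of `Π_e` trivially whenever `e` does NOT abut to `v`, then `G.EdgeVerticialAbutment` holds.
[cite: HoshiMochizukiNodNon2011, Lem 1.7 p.290] -/
theorem edgeVerticialAbutment_of_disjoint (hnt : ∀ e : G.graph.N ⊕ G.graph.C, G.edgeGp e ≠ ⊥)
    (hdis : ∀ (e : G.graph.N ⊕ G.graph.C) (v : G.graph.V), ¬ G.graph.Abuts e v →
      ∀ x : P, G.vertGp v ⊓ ConjAct.toConjAct x • G.edgeGp e = ⊥) :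
    G.EdgeVerticialAbutment := by
  classical
  intro v e g h hle
  by_contra hab
  rw [mulAut_conj_smul_eq, mulAut_conj_smul_eq] at hle
  have hle' : ConjAct.toConjAct (g⁻¹ * h) • G.edgeGp e ≤ G.vertGp v := by
    have := Subgroup.pointwise_smul_le_pointwise_smul_iff (a := ConjAct.toConjAct g⁻¹) |>.mpr hle
    rwa [← mul_smul, ← mul_smul, ← map_mul, ← map_mul, inv_mul_cancel, map_one, one_smul] at this
  have hb := hdis e v hab (g⁻¹ * h)
  rw [inf_eq_right.mpr hle'] at hb
  have hb' := congrArg (fun H : Subgroup P => (ConjAct.toConjAct (g⁻¹ * h))⁻¹ • H) hb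
  simp only [inv_smul_smul, Subgroup.smul_bot] at hb'
  exact hnt e hb'

/-- **One vertex: every edge abuts it**, so the abutment clause holds trivially (irreducible curves: smooth
curves, the irreducible nodal carriers). [cite: HoshiMochizukiNodNon2011, Lem 1.7 p.290] -/
theorem edgeVerticialAbutment_of_forall_eq (v₀ : G.graph.V) (hV : ∀ w, w = v₀) :
    G.EdgeVerticialAbutment := by
  rintro v (n | c) g h -
  · rw [abuts_inl_iff]
    obtain ⟨w₁, w₂, hends, -, -⟩ := G.nodeGp_le n
    rw [hends, hV w₁, ← hV v]
    exact Sym2.mem_mk_left _ _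
  · rw [abuts_inr_iff, hV (G.graph.cuspEnd c), hV v]

/-- **One vertex whose group is all of `Π_G`** (the genuine smooth-curve carriers): the containment clause
holds trivially. [cite: HoshiMochizukiNodNon2011, Lem 1.7 p.290] -/
theorem edgeVerticialContainment_of_vertGp_eq_top (v₀ : G.graph.V) (hV : ∀ w, w = v₀)
    (htop : G.vertGp v₀ = ⊤) : G.EdgeVerticialContainment := by
  intro v e g h _
  rw [hV v, htop]
  intro x _
  rw [Subgroup.mem_pointwise_smul_iff_inv_smul_mem]
  exact Subgroup.mem_top _

end General

/-! ### Instance: the genuine three-component chain data -/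

section ThreeChain

variable {P : Type u} [Group P] [TopologicalSpace P] [IsTopologicalGroup P]
variable [CompactSpace P] [T2Space P] [TotallyDisconnectedSpace P] {Sigma : Set ℕ} {g r : ℕ}

/-- **[NodNon] Lemma 1.7 (both typed clauses) at every genuine THREE-COMPONENT CHAIN datum whose
semi-graph records the incidences** (`nodeEnds ν_A = s(v₀, v_mid)`, `nodeEnds ν_B = s(v_mid, v₁)`, every
cusp group inside the group of its `cuspEnd`): by the criteria above, fed from abc-iut-f-164's
`threeChain_freeFactor_package` and `infinite_cuspInertia_closure`.
[cite: HoshiMochizukiNodNon2011, Lem 1.7 p.290] -/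
theorem edgeVerticialContainment_and_abutment_of_threeChain (hne : Sigma.Nonempty)
    (hprime : ∀ p ∈ Sigma, p.Prime) (ι : PuncturedSurfaceGroup g r →* P)
    (hι : IsProSigmaCompletion Sigma ι) (G : PSCDatum P) {g₀ g₁ s₁ s₂ : ℕ} (hg : g₀ ≤ g₁) (hs₁ : 2 ≤ s₁)
    (hs₁₂ : s₁ + 2 ≤ s₂) (hs₂ : s₂ + 2 ≤ r) (e : G.graph.C ≃ Fin r)
    (hC : ∀ c, G.cuspGp c =
      ((PuncturedSurfaceGroup.cuspInertia (g := g) (e c)).map ι).topologicalClosure)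
    (v₀ vm v₁ : G.graph.V) (hV : ∀ w, w = v₀ ∨ w = vm ∨ w = v₁) (εA η : PuncturedSurfaceGroup g r)
    (hεA : εA = ((List.finRange r).map fun j : Fin r =>
          if s₂ ≤ (j : ℕ) then PuncturedSurfaceGroup.c (g := g) j else 1).prod *
        ((List.finRange g).map fun i : Fin g => if (i : ℕ) < g₀ then
          PuncturedSurfaceGroup.a (r := r) i * PuncturedSurfaceGroup.b i *
            (PuncturedSurfaceGroup.a i)⁻¹ * (PuncturedSurfaceGroup.b i)⁻¹ else 1).prod)
    (hη : η = ((List.finRange r).map fun j : Fin r =>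
          if s₁ ≤ (j : ℕ) then PuncturedSurfaceGroup.c (g := g) j else 1).prod *
        ((List.finRange g).map fun i : Fin g => if (i : ℕ) < g₁ then
          PuncturedSurfaceGroup.a (r := r) i * PuncturedSurfaceGroup.b i *
            (PuncturedSurfaceGroup.a i)⁻¹ * (PuncturedSurfaceGroup.b i)⁻¹ else 1).prod)
    (hV₀ : G.vertGp v₀ = ((Subgroup.closure {x : PuncturedSurfaceGroup g r |
        (∃ i : Fin g, (i : ℕ) < g₀ ∧ (x = PuncturedSurfaceGroup.a i ∨ x = PuncturedSurfaceGroup.b i)) ∨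
        ∃ j : Fin r, s₂ ≤ (j : ℕ) ∧ x = PuncturedSurfaceGroup.c j}).map ι).topologicalClosure)
    (hVm : G.vertGp vm = ((Subgroup.closure {x : PuncturedSurfaceGroup g r |
        (∃ i : Fin g, (g₀ ≤ (i : ℕ) ∧ (i : ℕ) < g₁) ∧
          (x = PuncturedSurfaceGroup.a i ∨ x = PuncturedSurfaceGroup.b i)) ∨
        (∃ j : Fin r, (s₁ ≤ (j : ℕ) ∧ (j : ℕ) < s₂) ∧ x = PuncturedSurfaceGroup.c j) ∨
        x = εA ∨ x = η}).map ι).topologicalClosure)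
    (hV₁ : G.vertGp v₁ = ((Subgroup.closure {x : PuncturedSurfaceGroup g r |
        (∃ i : Fin g, g₁ ≤ (i : ℕ) ∧ (x = PuncturedSurfaceGroup.a i ∨ x = PuncturedSurfaceGroup.b i)) ∨
        (∃ j : Fin r, (j : ℕ) < s₁ ∧ x = PuncturedSurfaceGroup.c j) ∨ x = η}).map ι).topologicalClosure)
    (nA nB : G.graph.N) (hN : ∀ n, n = nA ∨ n = nB)
    (hEA : G.nodeGp nA = ((Subgroup.zpowers εA).map ι).topologicalClosure)
    (hEB : G.nodeGp nB = ((Subgroup.zpowers η).map ι).topologicalClosure)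
    (hendsA : G.graph.nodeEnds nA = s(v₀, vm)) (hendsB : G.graph.nodeEnds nB = s(vm, v₁))
    (hcuspEnd : ∀ c, G.cuspGp c ≤ G.vertGp (G.graph.cuspEnd c)) :
    G.EdgeVerticialContainment ∧ G.EdgeVerticialAbutment := by
  classical
  have hhyp : PuncturedSurfaceGroup.IsHyperbolicType g r := by
    unfold PuncturedSurfaceGroup.IsHyperbolicType; omega
  obtain ⟨-, -, hmal, hinf, -, -, -, ⟨hA₀, hAm, hA₁, hBm, hB₁, hB₀⟩, hcusp, ⟨h0m, hm1, h01, hAB⟩, -⟩ :=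
    G.threeChain_freeFactor_package hne hprime ι hι hg hs₁ hs₁₂ hs₂ e hC v₀ vm v₁ hV εA η hεA hη hV₀
      hVm hV₁ nA nB hN hEA hEB
  -- the three vertices are pairwise distinct
  have hv0m : v₀ ≠ vm := fun h => h0m (by rw [h])
  have hvm1 : vm ≠ v₁ := fun h => hm1 (by rw [h])
  have hv01 : v₀ ≠ v₁ := fun h => h01 (by rw [h])
  -- cusps: the package's vertex `u` is `cuspEnd c`
  have hcusp' : ∀ c, ∀ w, w ≠ G.graph.cuspEnd c →
      ∀ x : P, G.cuspGp c ⊓ ConjAct.toConjAct x • G.vertGp w = ⊥ := by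
    intro c w hw x
    obtain ⟨u, hu, hdis⟩ := hcusp c
    have huc : u = G.graph.cuspEnd c := by
      by_contra huc
      have hb := hdis (G.graph.cuspEnd c) (Ne.symm huc) 1
      rw [map_one, one_smul, inf_eq_left.mpr (hcuspEnd c)] at hb
      haveI := infinite_cuspInertia_closure hne hprime hhyp ι hι (e c)
      rw [← hC c] at this
      rw [hb] at this
      exact this.not_finite inferInstance
    exact hdis w (by rwa [huc]) x
  -- edge groups are non-trivial
  have hnt : ∀ e' : G.graph.N ⊕ G.graph.C, G.edgeGp e' ≠ ⊥ := by
    rintro (n | c)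
    · change G.nodeGp n ≠ ⊥
      intro hb
      have := hinf n
      rw [hb] at this
      exact this.not_finite inferInstance
    · change G.cuspGp c ≠ ⊥
      intro hb
      haveI := infinite_cuspInertia_closure hne hprime hhyp ι hι (e c)
      rw [← hC c, hb] at this
      exact this.not_finite inferInstance
  -- the incidence table: abutting ⇒ a conjugate inside; not abutting ⇒ everywhere disjoint
  have hnode : ∀ (n : G.graph.N) (v : G.graph.V),
      (v ∈ G.graph.nodeEnds n → G.nodeGp n ≤ G.vertGp v) ∧
      (v ∉ G.graph.nodeEnds n → ∀ x : P, G.vertGp v ⊓ ConjAct.toConjAct x • G.nodeGp n = ⊥) := by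
    intro n v
    rcases hN n with rfl | rfl
    · rw [hendsA]
      rcases hV v with rfl | rfl | rfl
      · exact ⟨fun _ => hA₀, fun h => absurd (Sym2.mem_mk_left _ _) h⟩
      · exact ⟨fun _ => hAm, fun h => absurd (Sym2.mem_mk_right _ _) h⟩
      · refine ⟨fun h => ?_, fun _ x => inf_conj_eq_bot_symm hA₁ x⟩
        rcases Sym2.mem_iff.mp h with h | h
        · exact absurd h.symm hv01
        · exact absurd h.symm hvm1
    · rw [hendsB]
      rcases hV v with rfl | rfl | rfl
      · refine ⟨fun h => ?_, fun _ x => inf_conj_eq_bot_symm hB₀ x⟩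
        rcases Sym2.mem_iff.mp h with h | h
        · exact absurd h hv0m
        · exact absurd h hv01
      · exact ⟨fun _ => hBm, fun h => absurd (Sym2.mem_mk_left _ _) h⟩
      · exact ⟨fun _ => hB₁, fun h => absurd (Sym2.mem_mk_right _ _) h⟩
  refine ⟨G.edgeVerticialContainment_of_malnormal hmal ?_, G.edgeVerticialAbutment_of_disjoint hnt ?_⟩
  · rintro (n | c) v
    · by_cases h : v ∈ G.graph.nodeEnds n
      · exact Or.inl ⟨1, by rw [map_one, one_smul]; exact (hnode n v).1 h⟩
      · exact Or.inr ((hnode n v).2 h)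
    · by_cases h : G.graph.cuspEnd c = v
      · exact Or.inl ⟨1, by rw [map_one, one_smul, ← h]; exact hcuspEnd c⟩
      · exact Or.inr fun x => inf_conj_eq_bot_symm (hcusp' c v (Ne.symm h)) x
  · rintro (n | c) v hab x
    · exact (hnode n v).2 (by rwa [abuts_inl_iff] at hab) x
    · exact inf_conj_eq_bot_symm (hcusp' c v (fun h => hab (by rw [abuts_inr_iff, h]))) x

end ThreeChain

end PSCDatum

end Literature.AnabelianGeometry.SemiGraphs

end
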